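import Mathlib
import Summits.CriticalPhenomena.PercolationContinuityZ3.Theorems.PercNearOneGluingNoHeavyLowerTailBlockOnePrivateGluing
import Summits.CriticalPhenomena.PercolationContinuityZ3.Theorems.PercNearOneGluingNoHeavyLowerTailPocketSizeGluing
import Summits.CriticalPhenomena.PercolationContinuityZ3.Theorems.PercNearOneGluingAdditiveGluingPartial
import Literature.Probability.Percolation.KozmaNitzanPinning
import Literature.Probability.Percolation.LongRangeKernelPercolationProofs
import HarnessLib

/-!
# Crux `PercNearOneGluing.NoHeavyLowerTail` (stmt-CriticalPhenomena-4575), line `bhk-superadditivity-thinning` —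
# TWO PRIVATE NEIGHBOURS: additive gluing with constant `2` (a LINEAR rate beyond Kozma–Nitzan's Theorem 5)

Lead prover-line-stmt-CriticalPhenomena-4575-c5-0, 2026-08-16.  Proves the registered stub `twoPrivateGluing`;
lands with `--supports stmt-CriticalPhenomena-4575`.

## Statement

Finite weighted graph on `Fin n`, relay set `A ∋ b`, observer `o ∉ A` whose non-relay neighbours are (at
most) two distinct PRIVATE vertices `x, x' ∉ A`: every positive-weight pair at `o` goes into
`A ∪ {x, x'}`, every positive-weight pair at `x` into `A ∪ {o}`, every positive-weight pair at `x'` into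
`A ∪ {o}` (so `x ≁ x'`).  If `μ(a ↔ b) ≥ 1 − t` for all `a ∈ A` then

  `μ(o ↔ A) − 2t ≤ μ(o ↔ b)`,   i.e.  `P(o ↔ A, o ↮ b) ≤ 2 · max_a P(a ↮ b)`.

Kozma–Nitzan (arXiv:2401.12397 Thm 5, p. 13) prove the sharp inequality (constant `1`, indeed the pre-FKG
form) for ONE private neighbour; their goodness recursion does not close for two, because gluing the
layer `{x, x'}` may re-order the relays (the hypothesis HT of crux 4576).  Here the constant `2` buys a
way round: REVEAL the edge `e = o–x` first.  The companion result `pocketGluing_oneLayer` gives, for ANY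
number of private neighbours, the square-root rate `bad² ≤ max_a P(a ↮ b)`; the present one is linear.
As `NearOneGluing` on this class: `δ = ε/3`.

## Proof

`μ(E) = w_e · μ₁(E) + (1 − w_e) · μ₀(E)` for every event, `μ₁, μ₀` the laws with `e` pinned open /
closed (`prodBernoulli_real_inter_localCylinder`).  Under `μ₀` the observer `o` has the single private
neighbour `x'` (and `x` has become an environment vertex attached to relays only); under `μ₁ = glue w {o,x}`
the glued block `{o, x}` has the single private neighbour `x'`.  Kozma–Nitzan's Theorem 5 in block form
(`blockOnePrivateGluing`) bounds both badnesses by the respective worst relay unreliability `t₁`, `t₀`; and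
`w_e t₁ ≤ μ(a₁ ↮ b) ≤ t`, `(1 − w_e) t₀ ≤ μ(a₀ ↮ b) ≤ t` for the maximisers `a₁, a₀`.  (The general
principle: revealing `K` edges costs at most the factor `2^K` — `E_branch[max_a] ≤ Σ_branch max_a`.)
No new definitions.
-/

namespace Summit.CriticalPhenomena.PercolationContinuityZ3.Theorems

open MeasureTheory Set
open Literature.Probability.LatticeModels (prodBernoulli)
open Literature.Probability.Percolation

noncomputable section
open Classical

variable {n : ℕ}

/-- **Revealing one pair.**  For every event `E` and pair `e`:
`μ_w(E) = w_e · μ_{pin e open}(E) + (1 − w_e) · μ_{pin e closed}(E)`. [folklore] -/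
theorem twoPrivate_reveal (w : Sym2 (Fin n) → unitInterval) (e : Sym2 (Fin n))
    (E : Set (BondConfig (Fin n))) :
    (prodBernoulli w).real E =
      (w e : ℝ) * (prodBernoulli (pinW w (↑({e} : Finset (Sym2 (Fin n))))
        (↑({e} : Finset (Sym2 (Fin n)))))).real E +
      (1 - (w e : ℝ)) * (prodBernoulli (pinW w (↑({e} : Finset (Sym2 (Fin n))))
        (∅ : Set (Sym2 (Fin n))))).real E := by
  have hE : MeasurableSet E := pocketGlue_measurableSet E
  -- the two cylinders over `{e}`
  have hsplit : E = (E ∩ localCylinder (↑({e} : Finset (Sym2 (Fin n)))) (↑({e} : Finset (Sym2 (Fin n))))) ∪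
      (E ∩ localCylinder (↑({e} : Finset (Sym2 (Fin n)))) (∅ : Set (Sym2 (Fin n)))) := by
    ext ω
    simp only [Set.mem_union, Set.mem_inter_iff, localCylinder, Set.mem_setOf_eq, Finset.coe_singleton,
      Set.mem_singleton_iff, forall_eq, Set.mem_empty_iff_false, iff_false]
    tauto
  have hdisj : Disjoint (E ∩ localCylinder (↑({e} : Finset (Sym2 (Fin n)))) (↑({e} : Finset (Sym2 (Fin n)))))
      (E ∩ localCylinder (↑({e} : Finset (Sym2 (Fin n)))) (∅ : Set (Sym2 (Fin n)))) := by
    rw [Set.disjoint_left]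
    rintro ω ⟨-, h1⟩ ⟨-, h0⟩
    have h1' : e ∈ ω ↔ e ∈ (↑({e} : Finset (Sym2 (Fin n))) : Set (Sym2 (Fin n))) := h1 e (by simp)
    have h0' : e ∈ ω ↔ e ∈ (∅ : Set (Sym2 (Fin n))) := h0 e (by simp)
    simp only [Finset.coe_singleton, Set.mem_singleton_iff, iff_true] at h1'
    exact (h0'.1 h1')
  have hcyl1 : (prodBernoulli w).real (localCylinder (↑({e} : Finset (Sym2 (Fin n))))
      (↑({e} : Finset (Sym2 (Fin n))))) = (w e : ℝ) := by
    rw [prodBernoulli_real_localCylinder, Finset.prod_singleton]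
    simp
  have hcyl0 : (prodBernoulli w).real (localCylinder (↑({e} : Finset (Sym2 (Fin n))))
      (∅ : Set (Sym2 (Fin n)))) = 1 - (w e : ℝ) := by
    rw [prodBernoulli_real_localCylinder, Finset.prod_singleton]
    simp
  conv_lhs => rw [hsplit]
  rw [measureReal_union hdisj ((pocketGlue_measurableSet _).inter (pocketGlue_measurableSet _)),
    prodBernoulli_real_inter_localCylinder w {e} _ hE,
    prodBernoulli_real_inter_localCylinder w {e} _ hE, hcyl1, hcyl0]

/-- Pinning the pair `s(o, x)` open is gluing the block `{o, x}`: the two weight functions coincide. -/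
theorem twoPrivate_glue_pair (w : Sym2 (Fin n) → unitInterval) (o x : Fin n) :
    (fun e : Sym2 (Fin n) => if (∀ y ∈ e, y ∈ ({o, x} : Finset (Fin n))) ∧ ¬ e.IsDiag then 1 else
      pinW w (↑({s(o, x)} : Finset (Sym2 (Fin n)))) (↑({s(o, x)} : Finset (Sym2 (Fin n)))) e) =
    pinW w (↑({s(o, x)} : Finset (Sym2 (Fin n)))) (↑({s(o, x)} : Finset (Sym2 (Fin n)))) := by
  funext e
  induction e using Sym2.ind with
  | h u v =>
    by_cases h : (∀ y ∈ s(u, v), y ∈ ({o, x} : Finset (Fin n))) ∧ ¬ (s(u, v)).IsDiag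
    · rw [if_pos h]
      obtain ⟨h1, h2⟩ := h
      have hu := h1 u (Sym2.mem_mk_left u v)
      have hv := h1 v (Sym2.mem_mk_right u v)
      rw [Sym2.mk_isDiag_iff] at h2
      simp only [Finset.mem_insert, Finset.mem_singleton] at hu hv
      have heq : s(u, v) = s(o, x) := by
        rcases hu with hu | hu <;> rcases hv with hv | hv <;> rw [hu, hv] at h2 ⊢ <;>
          first | rfl | exact Sym2.eq_swap | exact absurd rfl h2
      rw [heq, pinW_apply_of_mem_of_mem w (by simp) (by simp)]
    · rw [if_neg h]

/-- Under a weighting in which `s(o, x)` has weight `1`, the block events of `{o, x}` are the events of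
`o` almost surely: `μ(⋃_{o' ∈ {o,x}} E o') = μ(E o)` whenever `E x ∩ {s(o,x) open} ⊆ E o`. -/
theorem twoPrivate_block_event (p : Sym2 (Fin n) → unitInterval) {o x : Fin n} (hp : p s(o, x) = 1)
    (E : Fin n → Set (BondConfig (Fin n)))
    (hE : ∀ ω : BondConfig (Fin n), s(o, x) ∈ ω → ω ∈ E x → ω ∈ E o) :
    (prodBernoulli p).real (⋃ o' ∈ ({o, x} : Finset (Fin n)), E o') = (prodBernoulli p).real (E o) := by
  refine measureReal_congr ?_
  filter_upwards [prodBernoulli_ae_mem_of_eq_one p hp] with ω hω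
  refine propext ⟨fun h => ?_, fun h => Set.mem_iUnion₂.2 ⟨o, by simp, h⟩⟩
  obtain ⟨o', ho', hω'⟩ := Set.mem_iUnion₂.1 h
  have ho'' : o' = o ∨ o' = x := by simpa only [Finset.mem_insert, Finset.mem_singleton] using ho'
  rcases ho'' with h1 | h1
  · rw [h1] at hω'
    exact hω'
  · rw [h1] at hω'
    exact hE ω hω hω'

/-- **Two private neighbours: additive gluing with constant `2`** (registered stub `twoPrivateGluing` of
crux stmt-CriticalPhenomena-4575, line `bhk-superadditivity-thinning`).  `o ∉ A`, `b ∈ A`, `x, x' ∉ A`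
distinct and different from `o`; every positive-weight pair at `o` goes into `A ∪ {x, x'}`, at `x` into
`A ∪ {o}`, at `x'` into `A ∪ {o}`; `0 ≤ t` and `μ(a ↔ b) ≥ 1 − t` on `A`.  Then `μ(o ↔ A) − 2t ≤ μ(o ↔ b)`.
Reveal the pair `o–x` and apply Kozma–Nitzan's Theorem 5 in block form (`blockOnePrivateGluing`) to the
block `{o, x}` (pair open) and to `{o}` (pair closed). -/
theorem twoPrivateGluing : ∀ (n : ℕ) (w : Sym2 (Fin n) → unitInterval) (A : Finset (Fin n)) (o x x' b : Fin n) (t : ℝ), o ∉ A → b ∈ A → x ∉ A → x' ∉ A → x ≠ o → x' ≠ o → x ≠ x' → (∀ y : Fin n, y ∉ A → y ≠ o → y ≠ x → y ≠ x' → w s(o, y) = 0) → (∀ y : Fin n, y ∉ A → y ≠ o → y ≠ x → w s(x, y) = 0) → (∀ y : Fin n, y ∉ A → y ≠ o → y ≠ x' → w s(x', y) = 0) → 0 ≤ t → (∀ a ∈ A, 1 - t ≤ (Literature.Probability.LatticeModels.prodBernoulli w).real (Literature.Probability.Percolation.openConn a b)) → (Literature.Probability.LatticeModels.prodBernoulli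 w).real (⋃ a ∈ A, Literature.Probability.Percolation.openConn o a) - 2 * t ≤ (Literature.Probability.LatticeModels.prodBernoulli w).real (Literature.Probability.Percolation.openConn o b) := by
  intro n w A o x x' b t hoA hbA hxA hx'A hxo hx'o hxx' hiso hisox hisox' _ht hrel
  -- the revealed pair and the two pinned weightings
  set F : Finset (Sym2 (Fin n)) := {s(o, x)} with hF
  set w₁ : Sym2 (Fin n) → unitInterval := pinW w (↑F : Set (Sym2 (Fin n))) (↑F : Set (Sym2 (Fin n)))
    with hw₁
  set w₀ : Sym2 (Fin n) → unitInterval := pinW w (↑F : Set (Sym2 (Fin n))) (∅ : Set (Sym2 (Fin n)))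
    with hw₀
  have hmemF : s(o, x) ∈ (↑F : Set (Sym2 (Fin n))) := by simp [hF]
  have hmemF_iff : ∀ u v : Fin n, s(u, v) ∈ (↑F : Set (Sym2 (Fin n))) ↔
      (u = o ∧ v = x) ∨ (u = x ∧ v = o) := by
    intro u v
    rw [hF, Finset.coe_singleton, Set.mem_singleton_iff, Sym2.eq_iff]
  have hne_o : ∀ y : Fin n, y ≠ x → s(o, y) ∉ (↑F : Set (Sym2 (Fin n))) := by
    intro y hy h
    rcases (hmemF_iff o y).1 h with ⟨-, h⟩ | ⟨h, -⟩
    · exact hy h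
    · exact hxo h.symm
  have hne_x' : ∀ y : Fin n, s(x', y) ∉ (↑F : Set (Sym2 (Fin n))) := by
    intro y h
    rcases (hmemF_iff x' y).1 h with ⟨h, -⟩ | ⟨h, -⟩
    · exact hx'o h
    · exact hxx' h.symm
  have hne_x : ∀ y : Fin n, y ≠ o → s(x, y) ∉ (↑F : Set (Sym2 (Fin n))) := by
    intro y hy h
    rcases (hmemF_iff x y).1 h with ⟨h, -⟩ | ⟨-, h⟩
    · exact hxo h
    · exact hy h
  -- ### the closed branch: `o` with the single private neighbour `x'`
  obtain ⟨a₀, ha₀, hmax₀⟩ := Finset.exists_max_image A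
    (fun a => (prodBernoulli w₀).real (openConn a b)ᶜ) ⟨b, hbA⟩
  set t₀ : ℝ := (prodBernoulli w₀).real (openConn a₀ b)ᶜ with ht₀
  have ht₀0 : 0 ≤ t₀ := measureReal_nonneg
  have hrel₀ : ∀ a ∈ A, 1 - t₀ ≤ (prodBernoulli (fun e : Sym2 (Fin n) =>
      if (∀ y ∈ e, y ∈ ({o} : Finset (Fin n))) ∧ ¬ e.IsDiag then 1 else w₀ e)).real (openConn a b) := by
    intro a ha
    rw [agPartial_glue_singleton]
    have h := hmax₀ a ha
    rw [probReal_compl_eq_one_sub (pocketGlue_measurableSet _)] at h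
    linarith
  have hiso₀ : ∀ o' ∈ ({o} : Finset (Fin n)), ∀ y : Fin n, y ∉ ({o} : Finset (Fin n)) → y ∉ A →
      y ≠ x' → w₀ s(o', y) = 0 := by
    intro o' ho' y hyo hyA hyx'
    rw [Finset.mem_singleton] at ho'
    rw [ho']
    rw [Finset.mem_singleton] at hyo
    by_cases hyx : y = x
    · rw [hyx, hw₀]
      exact pinW_apply_of_mem_of_not_mem w hmemF (Set.notMem_empty _)
    · rw [hw₀, pinW_apply_of_not_mem w _ (hne_o y hyx)]
      exact hiso y hyA hyo hyx hyx'
  have hisox'₀ : ∀ y : Fin n, y ∉ ({o} : Finset (Fin n)) → y ∉ A → y ≠ x' → w₀ s(x', y) = 0 := by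
    intro y hyo hyA hyx'
    rw [Finset.mem_singleton] at hyo
    rw [hw₀, pinW_apply_of_not_mem w _ (hne_x' y)]
    exact hisox' y hyA hyo hyx'
  have hC₀ := blockOnePrivateGluing n w₀ {o} A x' b t₀ (Finset.disjoint_singleton_left.2 hoA) hbA
    (by rwa [Finset.mem_singleton]) hx'A hiso₀ hisox'₀ ht₀0 hrel₀
  rw [agPartial_glue_singleton, Finset.set_biUnion_singleton, Finset.set_biUnion_singleton] at hC₀
  -- ### the open branch: the block `{o, x}` with the single private neighbour `x'`
  obtain ⟨a₁, ha₁, hmax₁⟩ := Finset.exists_max_image A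
    (fun a => (prodBernoulli w₁).real (openConn a b)ᶜ) ⟨b, hbA⟩
  set t₁ : ℝ := (prodBernoulli w₁).real (openConn a₁ b)ᶜ with ht₁
  have ht₁0 : 0 ≤ t₁ := measureReal_nonneg
  have hglue : (fun e : Sym2 (Fin n) => if (∀ y ∈ e, y ∈ ({o, x} : Finset (Fin n))) ∧ ¬ e.IsDiag
      then 1 else w₁ e) = w₁ := by
    rw [hw₁, hF]
    exact twoPrivate_glue_pair w o x
  have hrel₁ : ∀ a ∈ A, 1 - t₁ ≤ (prodBernoulli (fun e : Sym2 (Fin n) =>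
      if (∀ y ∈ e, y ∈ ({o, x} : Finset (Fin n))) ∧ ¬ e.IsDiag then 1 else w₁ e)).real (openConn a b) := by
    intro a ha
    rw [hglue]
    have h := hmax₁ a ha
    rw [probReal_compl_eq_one_sub (pocketGlue_measurableSet _)] at h
    linarith
  have hOA : Disjoint ({o, x} : Finset (Fin n)) A := by
    rw [Finset.disjoint_insert_left, Finset.disjoint_singleton_left]
    exact ⟨hoA, hxA⟩
  have hx'O : x' ∉ ({o, x} : Finset (Fin n)) := by
    simp only [Finset.mem_insert, Finset.mem_singleton, not_or]
    exact ⟨hx'o, fun h => hxx' h.symm⟩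
  have hiso₁ : ∀ o' ∈ ({o, x} : Finset (Fin n)), ∀ y : Fin n, y ∉ ({o, x} : Finset (Fin n)) → y ∉ A →
      y ≠ x' → w₁ s(o', y) = 0 := by
    intro o' ho' y hyO hyA hyx'
    simp only [Finset.mem_insert, Finset.mem_singleton, not_or] at ho' hyO
    obtain ⟨hyo, hyx⟩ := hyO
    rcases ho' with ho' | ho' <;> rw [ho']
    · rw [hw₁, pinW_apply_of_not_mem w _ (hne_o y hyx)]
      exact hiso y hyA hyo hyx hyx'
    · rw [hw₁, pinW_apply_of_not_mem w _ (hne_x y hyo)]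
      exact hisox y hyA hyo hyx
  have hisox'₁ : ∀ y : Fin n, y ∉ ({o, x} : Finset (Fin n)) → y ∉ A → y ≠ x' → w₁ s(x', y) = 0 := by
    intro y hyO hyA hyx'
    simp only [Finset.mem_insert, Finset.mem_singleton, not_or] at hyO
    rw [hw₁, pinW_apply_of_not_mem w _ (hne_x' y)]
    exact hisox' y hyA hyO.1 hyx'
  have hC₁ := blockOnePrivateGluing n w₁ {o, x} A x' b t₁ hOA hbA hx'O hx'A hiso₁ hisox'₁ ht₁0 hrel₁
  rw [hglue] at hC₁
  -- the block events of `{o, x}` are the events of `o` under `w₁`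
  have hw₁e : w₁ s(o, x) = 1 := by
    rw [hw₁]
    exact pinW_apply_of_mem_of_mem w hmemF hmemF
  have hadj : ∀ ω : BondConfig (Fin n), s(o, x) ∈ ω → (openGraph ω).Reachable o x := fun ω hω =>
    ((openGraph_adj ω o x).2 ⟨hω, fun h => hxo h.symm⟩).reachable
  have hEA : (prodBernoulli w₁).real (⋃ o' ∈ ({o, x} : Finset (Fin n)), ⋃ y ∈ A, openConn o' y) =
      (prodBernoulli w₁).real (⋃ y ∈ A, openConn o y) := by
    refine twoPrivate_block_event w₁ hw₁e (fun o' => ⋃ y ∈ A, openConn o' y) ?_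
    intro ω hω h
    simp only [Set.mem_iUnion, exists_prop] at h ⊢
    obtain ⟨y, hy, hxy⟩ := h
    exact ⟨y, hy, (hadj ω hω).trans hxy⟩
  have hEb : (prodBernoulli w₁).real (⋃ o' ∈ ({o, x} : Finset (Fin n)), openConn o' b) =
      (prodBernoulli w₁).real (openConn o b) := by
    refine twoPrivate_block_event w₁ hw₁e (fun o' => openConn o' b) ?_
    intro ω hω h
    exact (hadj ω hω).trans h
  rw [hEA, hEb] at hC₁
  -- ### assemble
  have hdecA := twoPrivate_reveal w s(o, x) (⋃ y ∈ A, openConn o y)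
  have hdecb := twoPrivate_reveal w s(o, x) (openConn o b)
  have hdec₁ := twoPrivate_reveal w s(o, x) (openConn a₁ b)ᶜ
  have hdec₀ := twoPrivate_reveal w s(o, x) (openConn a₀ b)ᶜ
  rw [← hF] at hdecA hdecb hdec₁ hdec₀
  rw [← hw₁, ← hw₀] at hdecA hdecb hdec₁ hdec₀
  have hp0 : 0 ≤ (w s(o, x) : ℝ) := unitInterval.nonneg _
  have hp1 : (w s(o, x) : ℝ) ≤ 1 := unitInterval.le_one _
  -- the two branch budgets are paid by the true unreliabilities of `a₁`, `a₀`
  have hr₁ : (prodBernoulli w).real (openConn a₁ b)ᶜ ≤ t := by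
    have h := hrel a₁ ha₁
    rw [probReal_compl_eq_one_sub (pocketGlue_measurableSet _)]
    linarith
  have hr₀ : (prodBernoulli w).real (openConn a₀ b)ᶜ ≤ t := by
    have h := hrel a₀ ha₀
    rw [probReal_compl_eq_one_sub (pocketGlue_measurableSet _)]
    linarith
  have hb₁ : (w s(o, x) : ℝ) * t₁ ≤ t := by
    have h0 : 0 ≤ (1 - (w s(o, x) : ℝ)) * (prodBernoulli w₀).real (openConn a₁ b)ᶜ :=
      mul_nonneg (by linarith) measureReal_nonneg
    rw [ht₁]
    linarith
  have hb₀ : (1 - (w s(o, x) : ℝ)) * t₀ ≤ t := by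
    have h0 : 0 ≤ (w s(o, x) : ℝ) * (prodBernoulli w₁).real (openConn a₀ b)ᶜ :=
      mul_nonneg hp0 measureReal_nonneg
    rw [ht₀]
    linarith
  have hC₁' := mul_le_mul_of_nonneg_left (sub_le_iff_le_add.1 hC₁) hp0
  have hC₀' := mul_le_mul_of_nonneg_left (sub_le_iff_le_add.1 hC₀) (by linarith : 0 ≤ 1 - (w s(o, x) : ℝ))
  rw [mul_add] at hC₁' hC₀'
  rw [hdecA, hdecb]
  linarith [hC₁', hC₀', hb₁, hb₀]

end

end Summit.CriticalPhenomena.PercolationContinuityZ3.Theorems
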